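import Summits.SmoothPoincare4.SmoothPoincare4.Theorems.CongruenceShadowsHeegaardHandlebodyCongruenceClosedLevelCollapse

/-!
# Reduction of crux `CongruenceShadows.HeegaardHandlebodyCongruenceClosed` to the stubs of line `pair-rigidity-retraction`
(item stmt-SmoothPoincare4-14596, route route-SmoothPoincare4-CongruenceShadows; `--supports` the crux)

Sorry-free glue of the lead's reshaped skeleton `Cruxes/HeegaardHandlebodyCongruenceClosed/Lines/pair-rigidity-retraction.lean`
(r1), stated in importable vocabulary only.  Notation as in `…LevelCollapse.lean`: `S = SurfaceGroup (3+3m)`,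
`N = s4Kernels.stabilizeIter m`, `T_ρ = (N₀, N₁, ρN₂)`, `G_ρ = S ⧸ (N₀ ⊔ N₁ ⊔ ρN₂)`.

* `isGroupTrisection_twisted_of_free` — `T_ρ` is a `(3+3m; m+1)` group trisection of `{1}` as soon as the two twisted
  pair quotients `S ⧸ ⟪N_i ∪ ρN₂⟫` (`i = 0,1`) are free of rank `m+1` and `G_ρ = 1`.
* `isProduct_of_iso`, `tripleJoin_eq_top_of_isProduct` — the crux conclusion for `ρ` is `Iso N T_ρ`; products glue
  simply connected 4-manifolds.
* `fineApprox_of_items` (= registered stub P4ᵢ `stub_fineApproxOfItems`) — stub P4 (fine approximation) follows from the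
  two EXISTING items `ShadowApproximation` (stmt-14595) and `WaldhausenPairs` (stmt-14592).
* `hhcc_of_parts` — the crux from the line's stubs P1 (finite quotients of shadow-standard pairs), P2 (profinite detection
  of freeness of twisted pair quotients), P3 (limits simply connected, genera ≥ 6) and the two existing items.
* `limitsSimplyConnected_of_hhcc`, `fineApprox_of_hhcc` — P3 and P4 are NECESSARY for the crux.
-/

noncomputable section

-- the prescribed namespace `Summit.<P>.<Sub>.…` duplicates `SmoothPoincare4` (P = Sub)
set_option linter.dupNamespace false

namespace Summit.SmoothPoincare4.SmoothPoincare4.Theorems.HeegaardHandlebodyCongruenceClosed.PairRigidityRetraction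

open Literature.Topology.FourManifolds Subgroup
open Summit.SmoothPoincare4.SmoothPoincare4.Theses.CongruenceShadows
  (HeegaardHandlebodyCongruenceClosed ShadowApproximation WaldhausenPairs)
open Summit.SmoothPoincare4.SmoothPoincare4.Theorems.WaldhausenPairs.Negative (stabilizeIter_isGroupTrisection)

/-! ## The twisted triple is a group trisection of `{1}` once its two new pair quotients are free -/

/-- **`T_ρ = (N₀, N₁, ρN₂)` is a `(3+3m; m+1)` group trisection of the trivial group** as soon as the two
twisted pair quotients `S ⧸ ⟪N₀ ∪ ρN₂⟫`, `S ⧸ ⟪N₁ ∪ ρN₂⟫` are free of rank `m+1` and `N₀ ⊔ N₁ ⊔ ρN₂ = ⊤`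
(`normal`: images of normal subgroups; `free_quotient`: `S ⧸ ρN₂ ≅ S ⧸ N₂` along `ρ`; `free_pairQuotient`:
`(0,1)` standard, `(0,2)`, `(1,2)` by hypothesis, the transposed pairs by symmetry; `triple`: trivial). [folklore] -/
theorem isGroupTrisection_twisted_of_free {m : ℕ} {ρ : SurfaceGroup (3 + 3 * m) ≃* SurfaceGroup (3 + 3 * m)}
    (h0 : IsFreeOfRank (SurfaceGroup (3 + 3 * m) ⧸ normalClosure
      ((s4Kernels.stabilizeIter m 0 : Set (SurfaceGroup (3 + 3 * m))) ∪
        ((s4Kernels.stabilizeIter m 2).map ρ.toMonoidHom : Subgroup (SurfaceGroup (3 + 3 * m))))) (m + 1))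
    (h1 : IsFreeOfRank (SurfaceGroup (3 + 3 * m) ⧸ normalClosure
      ((s4Kernels.stabilizeIter m 1 : Set (SurfaceGroup (3 + 3 * m))) ∪
        ((s4Kernels.stabilizeIter m 2).map ρ.toMonoidHom : Subgroup (SurfaceGroup (3 + 3 * m))))) (m + 1))
    (htop : s4Kernels.stabilizeIter m 0 ⊔ s4Kernels.stabilizeIter m 1 ⊔
      (s4Kernels.stabilizeIter m 2).map ρ.toMonoidHom = ⊤) :
    IsGroupTrisection (3 + 3 * m) (m + 1) (PUnit : Type)
      (![s4Kernels.stabilizeIter m 0, s4Kernels.stabilizeIter m 1, (s4Kernels.stabilizeIter m 2).map ρ.toMonoidHom] :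
        TrisectionKernels (3 + 3 * m)) := by
  set K : TrisectionKernels (3 + 3 * m) :=
    ![s4Kernels.stabilizeIter m 0, s4Kernels.stabilizeIter m 1, (s4Kernels.stabilizeIter m 2).map ρ.toMonoidHom] with hK
  have hK0 : K 0 = s4Kernels.stabilizeIter m 0 := rfl
  have hK1 : K 1 = s4Kernels.stabilizeIter m 1 := rfl
  have hK2 : K 2 = (s4Kernels.stabilizeIter m 2).map ρ.toMonoidHom := rfl
  have hN := stabilizeIter_isGroupTrisection m
  haveI h2n : (s4Kernels.stabilizeIter m 2).Normal := stabilizeIter_normal m 2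
  haveI h2n' : ((s4Kernels.stabilizeIter m 2).map ρ.toMonoidHom).Normal := map_stabilizeIter_normal m 2 ρ
  have h02 : IsFreeOfRank (K.pairQuotient 0 2) (m + 1) := h0
  have h12 : IsFreeOfRank (K.pairQuotient 1 2) (m + 1) := h1
  have symm : ∀ i j : Fin 3, IsFreeOfRank (K.pairQuotient i j) (m + 1) → IsFreeOfRank (K.pairQuotient j i) (m + 1) :=
    fun i j h => h.of_mulEquiv (QuotientGroup.quotientMulEquivOfEq (by rw [Set.union_comm]))
  refine ⟨?_, ?_, ?_, ?_⟩
  · intro i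
    fin_cases i
    · exact hN.normal 0
    · exact hN.normal 1
    · exact map_stabilizeIter_normal m 2 ρ
  · intro i
    fin_cases i
    · exact hN.free_quotient 0
    · exact hN.free_quotient 1
    · have h2 := hN.free_quotient 2
      change IsFreeOfRank (SurfaceGroup (3 + 3 * m) ⧸ normalClosure
        (((s4Kernels.stabilizeIter m 2).map ρ.toMonoidHom : Subgroup (SurfaceGroup (3 + 3 * m))) :
          Set (SurfaceGroup (3 + 3 * m)))) (3 + 3 * m)
      have e₁ : SurfaceGroup (3 + 3 * m) ⧸ normalClosure ((s4Kernels.stabilizeIter m 2 :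
          Subgroup (SurfaceGroup (3 + 3 * m))) : Set (SurfaceGroup (3 + 3 * m))) ≃*
          SurfaceGroup (3 + 3 * m) ⧸ s4Kernels.stabilizeIter m 2 :=
        QuotientGroup.quotientMulEquivOfEq (normalClosure_eq_self _)
      have e₂ : SurfaceGroup (3 + 3 * m) ⧸ s4Kernels.stabilizeIter m 2 ≃*
          SurfaceGroup (3 + 3 * m) ⧸ (s4Kernels.stabilizeIter m 2).map ρ.toMonoidHom :=
        QuotientGroup.congr (s4Kernels.stabilizeIter m 2) ((s4Kernels.stabilizeIter m 2).map ρ.toMonoidHom) ρ rfl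
      have e₃ : SurfaceGroup (3 + 3 * m) ⧸ (s4Kernels.stabilizeIter m 2).map ρ.toMonoidHom ≃*
          SurfaceGroup (3 + 3 * m) ⧸ normalClosure (((s4Kernels.stabilizeIter m 2).map ρ.toMonoidHom :
            Subgroup (SurfaceGroup (3 + 3 * m))) : Set (SurfaceGroup (3 + 3 * m))) :=
        QuotientGroup.quotientMulEquivOfEq (normalClosure_eq_self _).symm
      exact ((h2.of_mulEquiv e₁).of_mulEquiv e₂).of_mulEquiv e₃
  · intro i j hij
    fin_cases i <;> fin_cases j
    · exact absurd rfl hij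
    · exact hN.free_pairQuotient 0 1 (by decide)
    · exact h02
    · exact hN.free_pairQuotient 1 0 (by decide)
    · exact absurd rfl hij
    · exact h12
    · exact symm _ _ h02
    · exact symm _ _ h12
    · exact absurd rfl hij
  · have hnc : normalClosure (⋃ i, (K i : Set (SurfaceGroup (3 + 3 * m)))) = ⊤ := by
      rw [eq_top_iff, ← htop]
      refine sup_le (sup_le ?_ ?_) ?_
      · exact fun s hs => subset_normalClosure (Set.mem_iUnion.2 ⟨0, hs⟩)
      · exact fun s hs => subset_normalClosure (Set.mem_iUnion.2 ⟨1, hs⟩)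
      · exact fun s hs => subset_normalClosure (Set.mem_iUnion.2 ⟨2, hs⟩)
    haveI : Subsingleton (K.tripleQuotient) := by
      change Subsingleton (SurfaceGroup (3 + 3 * m) ⧸ normalClosure (⋃ i, (K i : Set (SurfaceGroup (3 + 3 * m)))))
      rw [hnc]
      exact QuotientGroup.subsingleton_quotient_top
    letI : Unique (K.tripleQuotient) := uniqueOfSubsingleton 1
    exact ⟨MulEquiv.ofUnique⟩

/-! ## The crux conclusion is `Iso N T_ρ` -/

/-- `Iso N T_ρ ⇒ ρ ∈ (A∩B)·C` (`x := α`, `c := α⁻¹ ∘ ρ`). [folklore] -/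
theorem isProduct_of_iso {m : ℕ} {ρ : SurfaceGroup (3 + 3 * m) ≃* SurfaceGroup (3 + 3 * m)}
    (h : TrisectionKernels.Iso (s4Kernels.stabilizeIter m)
      (![s4Kernels.stabilizeIter m 0, s4Kernels.stabilizeIter m 1, (s4Kernels.stabilizeIter m 2).map ρ.toMonoidHom] :
        TrisectionKernels (3 + 3 * m))) :
    ∃ x c : SurfaceGroup (3 + 3 * m) ≃* SurfaceGroup (3 + 3 * m),
      (s4Kernels.stabilizeIter m 0).map x.toMonoidHom = s4Kernels.stabilizeIter m 0 ∧
      (s4Kernels.stabilizeIter m 1).map x.toMonoidHom = s4Kernels.stabilizeIter m 1 ∧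
      (s4Kernels.stabilizeIter m 2).map c.toMonoidHom = s4Kernels.stabilizeIter m 2 ∧ ∀ s, ρ s = x (c s) := by
  obtain ⟨α, hα⟩ := h
  have h0 : (s4Kernels.stabilizeIter m 0).map α.toMonoidHom = s4Kernels.stabilizeIter m 0 := by simpa using hα 0
  have h1 : (s4Kernels.stabilizeIter m 1).map α.toMonoidHom = s4Kernels.stabilizeIter m 1 := by simpa using hα 1
  have h2 : (s4Kernels.stabilizeIter m 2).map α.toMonoidHom = (s4Kernels.stabilizeIter m 2).map ρ.toMonoidHom := by
    simpa using hα 2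
  refine ⟨α, ρ.trans α.symm, h0, h1, ?_, fun s => by simp⟩
  have ht : (ρ.trans α.symm).toMonoidHom = α.symm.toMonoidHom.comp ρ.toMonoidHom := MonoidHom.ext fun _ => rfl
  have hs : (α.trans α.symm).toMonoidHom = MonoidHom.id _ := MonoidHom.ext fun s => by simp
  have ht' : α.symm.toMonoidHom.comp α.toMonoidHom = (α.trans α.symm).toMonoidHom := MonoidHom.ext fun _ => rfl
  rw [ht, ← Subgroup.map_map, ← h2, Subgroup.map_map, ht', hs, Subgroup.map_id]

/-- `ρ ∈ (A∩B)·C ⇒ N₀ ⊔ N₁ ⊔ ρN₂ = ⊤` (a product glues a simply connected 4-manifold). [folklore] -/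
theorem tripleJoin_eq_top_of_isProduct {m : ℕ} {ρ : SurfaceGroup (3 + 3 * m) ≃* SurfaceGroup (3 + 3 * m)}
    (h : ∃ x c : SurfaceGroup (3 + 3 * m) ≃* SurfaceGroup (3 + 3 * m),
      (s4Kernels.stabilizeIter m 0).map x.toMonoidHom = s4Kernels.stabilizeIter m 0 ∧
      (s4Kernels.stabilizeIter m 1).map x.toMonoidHom = s4Kernels.stabilizeIter m 1 ∧
      (s4Kernels.stabilizeIter m 2).map c.toMonoidHom = s4Kernels.stabilizeIter m 2 ∧ ∀ s, ρ s = x (c s)) :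
    s4Kernels.stabilizeIter m 0 ⊔ s4Kernels.stabilizeIter m 1 ⊔ (s4Kernels.stabilizeIter m 2).map ρ.toMonoidHom = ⊤ := by
  obtain ⟨x, c, h0, h1, hc, hs⟩ := h
  have hρ : ρ.toMonoidHom = x.toMonoidHom.comp c.toMonoidHom := MonoidHom.ext fun s => hs s
  have h2 : (s4Kernels.stabilizeIter m 2).map ρ.toMonoidHom = (s4Kernels.stabilizeIter m 2).map x.toMonoidHom := by
    rw [hρ, ← Subgroup.map_map, hc]
  rw [h2, ← h0, ← h1, ← Subgroup.map_sup, ← Subgroup.map_sup, sup_stabilizeIter_eq_top]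
  exact Subgroup.map_top_of_surjective _ x.surjective

/-! ## Stub P4 from the two existing items; the crux from the parts; necessity of P3 and P4 -/

/-- **P4 (fine approximation) follows from `ShadowApproximation` (stmt-14595) and `WaldhausenPairs` (stmt-14592).**
For a product-congruent `ρ` whose twisted triple `T_ρ` is a `(3+3m; m+1)` group trisection of `{1}`: 14592
normalises all pairs of `T_ρ`, product-congruence supplies standard shadows, and 14595 concludes `Iso N T_ρ`. [folklore] -/
theorem fineApprox_of_items (hSA : ShadowApproximation) (hW : WaldhausenPairs) :
    ∀ (m : ℕ) (ρ : SurfaceGroup (3 + 3 * m) ≃* SurfaceGroup (3 + 3 * m)),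
      (∀ M : Subgroup (SurfaceGroup (3 + 3 * m)), M.Characteristic → M.FiniteIndex →
        ∃ x c : SurfaceGroup (3 + 3 * m) ≃* SurfaceGroup (3 + 3 * m),
          (s4Kernels.stabilizeIter m 0).map x.toMonoidHom = s4Kernels.stabilizeIter m 0 ∧
          (s4Kernels.stabilizeIter m 1).map x.toMonoidHom = s4Kernels.stabilizeIter m 1 ∧
          (s4Kernels.stabilizeIter m 2).map c.toMonoidHom = s4Kernels.stabilizeIter m 2 ∧
          ∀ s, ρ s * (x (c s))⁻¹ ∈ M) →
      IsGroupTrisection (3 + 3 * m) (m + 1) (PUnit : Type)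
        ![s4Kernels.stabilizeIter m 0, s4Kernels.stabilizeIter m 1, (s4Kernels.stabilizeIter m 2).map ρ.toMonoidHom] →
      TrisectionKernels.Iso (s4Kernels.stabilizeIter m)
        ![s4Kernels.stabilizeIter m 0, s4Kernels.stabilizeIter m 1, (s4Kernels.stabilizeIter m 2).map ρ.toMonoidHom] :=
  fun m ρ hρ hK =>
    hSA m ![s4Kernels.stabilizeIter m 0, s4Kernels.stabilizeIter m 1, (s4Kernels.stabilizeIter m 2).map ρ.toMonoidHom]
      hK (hW m _ hK) (tripleShadow_of_productCongruent hρ)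

/-- **The crux from the line's parts.** Stubs P1 (finite quotients of shadow-standard pairs), P2 (profinite
detection of freeness of twisted pair quotients), P3 (limits simply connected, genera `≥ 6`; genus 3 is
`limitsSimplyConnected_zero`) together with the EXISTING items `ShadowApproximation` (stmt-14595) and
`WaldhausenPairs` (stmt-14592) prove `HeegaardHandlebodyCongruenceClosed`. [folklore] -/
theorem hhcc_of_parts
    (hP1 : ∀ (m : ℕ) (i : Fin 3), i ≠ 2 → ∀ θ : SurfaceGroup (3 + 3 * m) ≃* SurfaceGroup (3 + 3 * m),
      (∀ M : Subgroup (SurfaceGroup (3 + 3 * m)), M.Characteristic → M.FiniteIndex →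
        ∃ a : SurfaceGroup (3 + 3 * m) ≃* SurfaceGroup (3 + 3 * m),
          (s4Kernels.stabilizeIter m i ⊔ M).map a.toMonoidHom = s4Kernels.stabilizeIter m i ⊔ M ∧
          (s4Kernels.stabilizeIter m 2 ⊔ M).map a.toMonoidHom =
            (s4Kernels.stabilizeIter m 2).map θ.toMonoidHom ⊔ M) →
      ∀ (Q : Type) [Group Q] [Finite Q],
        (∃ f : SurfaceGroup (3 + 3 * m) ⧸ normalClosure ((s4Kernels.stabilizeIter m i : Set (SurfaceGroup (3 + 3 * m))) ∪
            ((s4Kernels.stabilizeIter m 2).map θ.toMonoidHom : Subgroup (SurfaceGroup (3 + 3 * m)))) →* Q,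
          Function.Surjective f) ↔
        (∃ f : FreeGroup (Fin (m + 1)) →* Q, Function.Surjective f))
    (hP2 : ∀ (m : ℕ) (i : Fin 3), i ≠ 2 → ∀ θ : SurfaceGroup (3 + 3 * m) ≃* SurfaceGroup (3 + 3 * m),
      (∀ (Q : Type) [Group Q] [Finite Q],
        (∃ f : SurfaceGroup (3 + 3 * m) ⧸ normalClosure ((s4Kernels.stabilizeIter m i : Set (SurfaceGroup (3 + 3 * m))) ∪
            ((s4Kernels.stabilizeIter m 2).map θ.toMonoidHom : Subgroup (SurfaceGroup (3 + 3 * m)))) →* Q,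
          Function.Surjective f) ↔
        (∃ f : FreeGroup (Fin (m + 1)) →* Q, Function.Surjective f)) →
      IsFreeOfRank (SurfaceGroup (3 + 3 * m) ⧸ normalClosure
        ((s4Kernels.stabilizeIter m i : Set (SurfaceGroup (3 + 3 * m))) ∪
          ((s4Kernels.stabilizeIter m 2).map θ.toMonoidHom : Subgroup (SurfaceGroup (3 + 3 * m))))) (m + 1))
    (hP3 : ∀ (m : ℕ) (ρ : SurfaceGroup (3 + 3 * (m + 1)) ≃* SurfaceGroup (3 + 3 * (m + 1))),
      (∀ M : Subgroup (SurfaceGroup (3 + 3 * (m + 1))), M.Characteristic → M.FiniteIndex →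
        ∃ x c : SurfaceGroup (3 + 3 * (m + 1)) ≃* SurfaceGroup (3 + 3 * (m + 1)),
          (s4Kernels.stabilizeIter (m + 1) 0).map x.toMonoidHom = s4Kernels.stabilizeIter (m + 1) 0 ∧
          (s4Kernels.stabilizeIter (m + 1) 1).map x.toMonoidHom = s4Kernels.stabilizeIter (m + 1) 1 ∧
          (s4Kernels.stabilizeIter (m + 1) 2).map c.toMonoidHom = s4Kernels.stabilizeIter (m + 1) 2 ∧
          ∀ s, ρ s * (x (c s))⁻¹ ∈ M) →
      s4Kernels.stabilizeIter (m + 1) 0 ⊔ s4Kernels.stabilizeIter (m + 1) 1 ⊔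
        (s4Kernels.stabilizeIter (m + 1) 2).map ρ.toMonoidHom = ⊤)
    (hSA : ShadowApproximation) (hW : WaldhausenPairs) : HeegaardHandlebodyCongruenceClosed := by
  intro m ρ hρ
  -- shadow-standardness of the two pairs `(N_i, ρN₂)`, `i = 0, 1` (witness `x_M`)
  have hshadow : ∀ i : Fin 3, i ≠ 2 → ∀ M : Subgroup (SurfaceGroup (3 + 3 * m)), M.Characteristic → M.FiniteIndex →
      ∃ a : SurfaceGroup (3 + 3 * m) ≃* SurfaceGroup (3 + 3 * m),
        (s4Kernels.stabilizeIter m i ⊔ M).map a.toMonoidHom = s4Kernels.stabilizeIter m i ⊔ M ∧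
        (s4Kernels.stabilizeIter m 2 ⊔ M).map a.toMonoidHom = (s4Kernels.stabilizeIter m 2).map ρ.toMonoidHom ⊔ M := by
    intro i hi M hM hF
    obtain ⟨x, c, hx0, hx1, hc, hs⟩ := hρ M hM hF
    have hNi : (s4Kernels.stabilizeIter m i).map x.toMonoidHom = s4Kernels.stabilizeIter m i := by
      fin_cases i
      · exact hx0
      · exact hx1
      · exact absurd rfl hi
    refine ⟨x, ?_, ?_⟩
    · rw [Subgroup.map_sup, map_eq_of_characteristic x hM, hNi]
    · rw [Subgroup.map_sup, map_eq_of_characteristic x hM, map_sup_eq_of_congr hs (s4Kernels.stabilizeIter m 2), hc]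
  have hfree : ∀ i : Fin 3, i ≠ 2 → IsFreeOfRank (SurfaceGroup (3 + 3 * m) ⧸ normalClosure
      ((s4Kernels.stabilizeIter m i : Set (SurfaceGroup (3 + 3 * m))) ∪
        ((s4Kernels.stabilizeIter m 2).map ρ.toMonoidHom : Subgroup (SurfaceGroup (3 + 3 * m))))) (m + 1) :=
    fun i hi => hP2 m i hi ρ (hP1 m i hi ρ (hshadow i hi))
  have htop : s4Kernels.stabilizeIter m 0 ⊔ s4Kernels.stabilizeIter m 1 ⊔
      (s4Kernels.stabilizeIter m 2).map ρ.toMonoidHom = ⊤ := by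
    cases m with
    | zero => exact limitsSimplyConnected_zero ρ hρ
    | succ m => exact hP3 m ρ hρ
  exact isProduct_of_iso (fineApprox_of_items hSA hW m ρ hρ
    (isGroupTrisection_twisted_of_free (hfree 0 (by decide)) (hfree 1 (by decide)) htop))

/-- **Necessity of P3.** The crux implies that congruence limits of products glue simply connected 4-manifolds:
`N₀ ⊔ N₁ ⊔ ρN₂ = ⊤` for every product-congruent `ρ`, at every genus. [folklore] -/
theorem limitsSimplyConnected_of_hhcc (hC : HeegaardHandlebodyCongruenceClosed) (m : ℕ)
    (ρ : SurfaceGroup (3 + 3 * m) ≃* SurfaceGroup (3 + 3 * m))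
    (hρ : ∀ M : Subgroup (SurfaceGroup (3 + 3 * m)), M.Characteristic → M.FiniteIndex →
      ∃ x c : SurfaceGroup (3 + 3 * m) ≃* SurfaceGroup (3 + 3 * m),
        (s4Kernels.stabilizeIter m 0).map x.toMonoidHom = s4Kernels.stabilizeIter m 0 ∧
        (s4Kernels.stabilizeIter m 1).map x.toMonoidHom = s4Kernels.stabilizeIter m 1 ∧
        (s4Kernels.stabilizeIter m 2).map c.toMonoidHom = s4Kernels.stabilizeIter m 2 ∧
        ∀ s, ρ s * (x (c s))⁻¹ ∈ M) :
    s4Kernels.stabilizeIter m 0 ⊔ s4Kernels.stabilizeIter m 1 ⊔ (s4Kernels.stabilizeIter m 2).map ρ.toMonoidHom = ⊤ :=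
  tripleJoin_eq_top_of_isProduct (hC m ρ hρ)

/-- **Necessity of P4.** The crux implies fine approximation (its conclusion IS `Iso N T_ρ`, with carrier `x`).
[folklore] -/
theorem fineApprox_of_hhcc (hC : HeegaardHandlebodyCongruenceClosed) (m : ℕ)
    (ρ : SurfaceGroup (3 + 3 * m) ≃* SurfaceGroup (3 + 3 * m))
    (hρ : ∀ M : Subgroup (SurfaceGroup (3 + 3 * m)), M.Characteristic → M.FiniteIndex →
      ∃ x c : SurfaceGroup (3 + 3 * m) ≃* SurfaceGroup (3 + 3 * m),
        (s4Kernels.stabilizeIter m 0).map x.toMonoidHom = s4Kernels.stabilizeIter m 0 ∧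
        (s4Kernels.stabilizeIter m 1).map x.toMonoidHom = s4Kernels.stabilizeIter m 1 ∧
        (s4Kernels.stabilizeIter m 2).map c.toMonoidHom = s4Kernels.stabilizeIter m 2 ∧
        ∀ s, ρ s * (x (c s))⁻¹ ∈ M) :
    TrisectionKernels.Iso (s4Kernels.stabilizeIter m)
      (![s4Kernels.stabilizeIter m 0, s4Kernels.stabilizeIter m 1, (s4Kernels.stabilizeIter m 2).map ρ.toMonoidHom] :
        TrisectionKernels (3 + 3 * m)) := by
  obtain ⟨x, c, hx0, hx1, hc, hs⟩ := hC m ρ hρ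
  refine ⟨x, fun i => ?_⟩
  fin_cases i
  · exact hx0
  · exact hx1
  · show (s4Kernels.stabilizeIter m 2).map x.toMonoidHom = (s4Kernels.stabilizeIter m 2).map ρ.toMonoidHom
    have hρ' : ρ.toMonoidHom = x.toMonoidHom.comp c.toMonoidHom := MonoidHom.ext fun s => hs s
    rw [hρ', ← Subgroup.map_map, hc]

/-- **Registered stub P4ᵢ of line `pair-rigidity-retraction`** (signature verbatim as registered on
stmt-SmoothPoincare4-14596): P4 from the existing items 14595 and 14592, `= fineApprox_of_items`. [folklore] -/
theorem stub_fineApproxOfItems : Summit.SmoothPoincare4.SmoothPoincare4.Theses.CongruenceShadows.ShadowApproximation → Summit.SmoothPoincare4.SmoothPoincare4.Theses.CongruenceShadows.WaldhausenPairs → ∀ (m : ℕ) (ρ : Literature.Topology.FourManifolds.SurfaceGroup (3 + 3 * m) ≃* Literature.Topology.FourManifolds.SurfaceGroup (3 + 3 * m)), (∀ M : Subgroup (Literature.Topology.FourManifolds.SurfaceGroup (3 + 3 * m)), M.Characteristic → M.FiniteIndex → ∃ x c : Literature.Topology.FourManifolds.SurfaceGroup (3 + 3 * m) ≃* Literature.Topology.FourManifolds.SurfaceGroup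 (3 + 3 * m), (Literature.Topology.FourManifolds.s4Kernels.stabilizeIter m 0).map x.toMonoidHom = Literature.Topology.FourManifolds.s4Kernels.stabilizeIter m 0 ∧ (Literature.Topology.FourManifolds.s4Kernels.stabilizeIter m 1).map x.toMonoidHom = Literature.Topology.FourManifolds.s4Kernels.stabilizeIter m 1 ∧ (Literature.Topology.FourManifolds.s4Kernels.stabilizeIter m 2).map c.toMonoidHom = Literature.Topology.FourManifolds.s4Kernels.stabilizeIter m 2 ∧ ∀ s, ρ s * (x (c s))⁻¹ ∈ M) → Literature.Topology.FourManifolds.IsGroupTrisection (3 + 3 * m) (m + 1) (PUnit : Type) ![Literature.Topology.FourManifolds.s4Kernels.stabilizeIter m 0, Literature.Topology.FourManifolds.s4Kernels.stabilizeIter m 1, (Literature.Topology.FourManifolds.s4Kernels.stabilizeIter m 2).map ρ.toMonoidHom] → Literature.Topology.FourManifolds.TrisectionKernels.Iso (Literature.Topology.FourManifolds.s4Kernels.stabilizeIter m) ![Literature.Topology.FourManifolds.s4Kernels.stabilizeIter m 0, Literature.Topology.FourManifolds.s4Kernels.stabilizeIter m 1, (Literature.Topology.FourManifolds.s4Kernels.stabilizeIter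 m 2).map ρ.toMonoidHom] :=
  fun hSA hW => fineApprox_of_items hSA hW

end Summit.SmoothPoincare4.SmoothPoincare4.Theorems.HeegaardHandlebodyCongruenceClosed.PairRigidityRetraction

end
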